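import Summits.Langlands.Langlands.Theses.AbelianSurfaceSerre
import Literature.NumberTheory.PAdicHodge.FontaineDpst
import Literature.NumberTheory.GaloisRepresentations.LabelledHodgeTateWeights
import Literature.NumberTheory.GaloisRepresentations.CrystallineOrdinary
import Literature.FieldTheory.AlgClosed.PadicAlgClEquivComplex
import Summits.Langlands.Langlands.Theorems.AbelianSurfaceSerreSerreGSp4SurjectiveSingerDefs
import Summits.Langlands.Langlands.Theorems.AbelianSurfaceSerreSerreGSp4SurjectiveStubAutomorphyLifting
import HarnessLib

/-!
# Route `AbelianSurfaceSerre`, crux `SerreGSp4Surjective` (stmt-Langlands-17765): vocabulary of the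
# line `singer-type-evaporation`, skeleton v8 (the two-layer family)

Route-posited objects (D-0016 `<Route>Defs`-type file, sequel of
`AbelianSurfaceSerreSerreGSp4SurjectiveSingerDefs.lean`, p153996) shared by the registered stubs of the
checked skeleton `Cruxes/SerreGSp4Surjective/Lines/singer_type_evaporation.lean`, v8 (lead
prover-line-stmt-Langlands-17765-c1-0, 2026-08-17), so that a landed stub reads byte-identically to its
registration.  NOTHING IS ASSERTED by the definitions: every `def … : Prop` / `structure` below is a
statement or an interface consumed only as (part of) the type of a stub theorem.

Objects (all in the skeleton's namespace
`Summit.Langlands.Langlands.Cruxes.SerreGSp4Surjective.SingerTypeEvaporation`):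
* `PotentiallyCrystallineAt p r` — de Rham with `N = 0` on every attached Weil–Deligne representation
  at `v ∣ p`, for Fontaine's pinned datum (BLGGT14 §1.4; verbatim the second potential-diagonalizability
  alternative read by the accepted `BLGGT2014_thm551_compatibleSystem_rat_GL4`);
* `OrdinaryLift p ρ̄` — the `p`-adic layer of the family: a lift of `ρ̄` symplectic with multiplier
  EXACTLY `ε_p⁻¹`, unramified a.e., crystalline at `p` with four distinct labelled Hodge–Tate weights
  `wts ⊂ [lo, hi]`, potentially crystalline clause, Greenberg-ordinary on `Γ_{ℚ_p}` with strictly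
  increasing INTEGER cyclotomic exponents `b` (accepted `FramedRep.IsCrystallineOrdinaryOfExponents`),
  reducing to `ρ̄` (`ReducesTo`, the crux's device);
* `SingerFamily p ρ̄` — the family: an `OrdinaryLift` plus, for `ℓ` in a set `good` unbounded above, an
  `ℓ`-adic companion, crystalline at `ℓ` with the same labelled weights, a companion of the lift
  (`CompanionAE`), irreducible and residually irreducible on `Γ_{ℚ(ζ_ℓ)}` along every residue map
  (`ReducesAlong`, `IrredOnCycKernel`);
Not here (deliberately): the line's OPEN INPUT `FLFontaineMazur` (Fontaine–Mazur–Langlands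
reciprocity for Fontaine–Laffaille-crystalline, residually-big-image `Γ_ℚ → GL₄(ℚ̄_ℓ)`, all large `ℓ`)
— a conjecture, which stays a local `def` of the skeleton consumed only as the type of the registered
stub `stub_flFontaineMazur` (to be filed by a planner as a `@[conjecture]` obligation if promoted) —
and the composition glue that consumes it.

Proved here (so that this vocabulary lands through a registered stub): the line's stub 6/6
`stub_familyTransfer` (registered signature, verbatim) — automorphy passes from any companion to the
lift — and `SingerFamily.companion_unramified` (every companion is unramified a.e., read off
`CompanionAE`).

Why v8 (lead c1) replaced v6's residual-automorphy anchor and potentially-ordinary lift: module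
docstring of the skeleton (`Lines/singer_type_evaporation.lean`): the sign of the pairing of the
`ℓ`-adic companions is not served by any landed fact (needed by BLGGT Thm 4.2.1), and a potentially
ordinary lift forces a Hida-theoretic endgame; a crystalline-ordinary lift with integer exponents makes
the endgame `ℓ = p` local–global compatibility plus cyclotomic twists.

References: BarnetlambEtAl2014 §1.4, §5.1, Thm 5.5.1, Prop 5.3.2; FakhruddinKharePatrikis2021 Thm A;
PatrikisTaylor2014 Thm 1.7; FontaineMazurGeometric1995 Conj. 1; arXiv:2502.20645 Lemma 10.4.1 (the crux).
-/

set_option linter.dupNamespace false -- `Summit.Langlands.Langlands` is the mandated namespace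

namespace Summit.Langlands.Langlands.Cruxes.SerreGSp4Surjective.SingerTypeEvaporation

open Literature.NumberTheory.GaloisRepresentations Literature.NumberTheory.Automorphic
  Literature.NumberTheory.PAdicHodge
open scoped NumberField
open IsDedekindDomain Polynomial Filter

noncomputable section

/-- **`r` is potentially crystalline at every `v ∣ p`** relative to the pinned Fontaine datum:
de Rham and every attached Weil–Deligne representation has `N = 0` (BLGGT14 §1.4; the second
alternative of the accepted `BLGGT2014_thm551_compatibleSystem_rat_GL4` reads exactly this clause
together with an invariant full flag). [cite: BarnetlambEtAl2014, §1.4] -/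
def PotentiallyCrystallineAt (p : ℕ) [Fact p.Prime] (r : FramedGaloisRep ℚ (PadicAlgCl p) 4) :
    Prop :=
  ∀ (v : HeightOneSpectrum (𝓞 ℚ)) (hv : ((p : ℕ) : 𝓞 ℚ) ∈ v.asIdeal),
    (fontainePstAdicCompletion v p hv).IsDeRhamFramed (r.toLocal v) ∧
      ∀ W, (fontainePstAdicCompletion v p hv).IsWeilDeligneOf (r.toLocal v) W → W.N = 0

/-- **Crystalline-ordinary symplectic lift of `ρ̄`** (interface of the registered stub
`stub_liftExists`; an INTERFACE — data + properties —, its existence is the stub).  Data: the lift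
and its strictly increasing integer cyclotomic exponents `b` at `p`, the labelled Hodge–Tate weight
multiset `wts` inside `[lo, hi]`.  Properties: symplectic with multiplier EXACTLY `ε_p⁻¹` (`cycInv`;
parity is load-bearing, `Disproof.lean` §3, and the pinned multiplier forces `b 0 + b 3 = 1`, §3b —
negative exponents allowed); unramified at almost all places; crystalline at `p` with labelled weights
`wts` (`IsCrystallineWithWeightsAt`); de Rham with `N = 0` (`PotentiallyCrystallineAt`);
Greenberg-ordinary on `Γ_{ℚ_p}` with exponents `-b` — upper triangular with diagonal `ψ_i ε^{-b_i}`,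
`ψ_i` unramified (`FramedRep.IsCrystallineOrdinaryOfExponents`); reducing to `ρ̄` (`ReducesTo`).
[cite: BarnetlambEtAl2014, §1.4 and Prop. 3.2.1] [cite: FakhruddinKharePatrikis2021, Thm. A] -/
structure OrdinaryLift (p : ℕ) [Fact p.Prime] (ρ : FramedGaloisRep ℚ (ZMod p) 4) where
  /-- the `p`-adic lift of `ρ̄`, normalised to multiplier `ε⁻¹` -/
  lift : FramedGaloisRep ℚ (PadicAlgCl p) 4
  /-- its cyclotomic exponents at `p` (Hodge–Tate weights, sub-object first) -/
  b : Fin 4 → ℤ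
  /-- the exponents increase strictly along the flag -/
  b_strictMono : StrictMono b
  /-- the labelled Hodge–Tate weight multiset of the lift -/
  wts : Multiset ℤ
  /-- lower end of an interval containing the weights -/
  lo : ℤ
  /-- upper end of an interval containing the weights -/
  hi : ℤ
  /-- the weights are pairwise distinct -/
  wts_nodup : wts.Nodup
  /-- there are four of them -/
  wts_card : Multiset.card wts = 4
  /-- they lie in `[lo, hi]` -/
  wts_range : ∀ x ∈ wts, lo ≤ x ∧ x ≤ hi
  /-- symplectic with multiplier exactly `ε_p⁻¹` -/
  lift_symplectic : lift.IsSymplecticWithMultiplierFun (cycInv p)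
  /-- unramified at all but finitely many places -/
  lift_unramified : ∀ᶠ v : HeightOneSpectrum (𝓞 ℚ) in Filter.cofinite, lift.IsUnramifiedAt v
  /-- crystalline at `p` with labelled Hodge–Tate weights `wts` -/
  lift_crystalline : IsCrystallineWithWeightsAt p wts lift
  /-- de Rham with `N = 0` at `p` -/
  lift_potCrystalline : PotentiallyCrystallineAt p lift
  /-- Greenberg-ordinary on `Γ_{ℚ_v}`, `v ∣ p`, with exponents `-b` and unramified `ψ_i` -/
  lift_ordinary : ∀ v : HeightOneSpectrum (𝓞 ℚ), ((p : ℕ) : 𝓞 ℚ) ∈ v.asIdeal →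
    FramedRep.IsCrystallineOrdinaryOfExponents p (lift.toLocal v) (fun i => -(b i))
  /-- the integral characteristic polynomials of the lift reduce to those of `ρ̄ ⊗ 𝔽̄_p` -/
  lift_reducesTo : ReducesTo p lift ρ

/-- **Rigid family through `ρ̄`** (interface of the registered stubs `stub_companions` and
`stub_ordinaryEndgame`; name kept from v1 for registry continuity): an `OrdinaryLift` together with,
for every prime `ℓ` in a set `good` unbounded above, an `ℓ`-adic COMPANION which is crystalline at `ℓ`
with the same labelled weights `wts`, a companion of the lift (`CompanionAE`), irreducible, and
residually irreducible on `Γ_{ℚ(ζ_ℓ)}` along every residue map.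
[cite: BarnetlambEtAl2014, Thm 5.5.1 and Prop 5.3.2] [cite: PatrikisTaylor2014, Thm. 1.7] -/
structure SingerFamily (p : ℕ) [Fact p.Prime] (ρ : FramedGaloisRep ℚ (ZMod p) 4)
    extends OrdinaryLift p ρ where
  /-- the primes at which a companion is given and is (residually) irreducible -/
  good : Set ℕ
  /-- `good` is unbounded above -/
  good_unbounded : ∀ N : ℕ, ∃ ℓ : ℕ, ℓ.Prime ∧ ℓ ∈ good ∧ N ≤ ℓ
  /-- the `ℓ`-adic companion, `ℓ ∈ good` -/
  companion : ∀ (ℓ : ℕ) [Fact ℓ.Prime], ℓ ∈ good → FramedGaloisRep ℚ (PadicAlgCl ℓ) 4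
  /-- crystalline at `ℓ` with labelled weights `wts` -/
  companion_crystalline : ∀ (ℓ : ℕ) [Fact ℓ.Prime] (h : ℓ ∈ good),
    IsCrystallineWithWeightsAt ℓ wts (companion ℓ h)
  /-- a companion of the lift -/
  companion_compatible : ∀ (ℓ : ℕ) [Fact ℓ.Prime] (h : ℓ ∈ good),
    CompanionAE p ℓ lift (companion ℓ h)
  /-- irreducible -/
  companion_irreducible : ∀ (ℓ : ℕ) [Fact ℓ.Prime] (h : ℓ ∈ good),
    (companion ℓ h).toGaloisRep.IsIrreducible
  /-- residually irreducible on `Γ_{ℚ(ζ_ℓ)}` along every residue map -/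
  companion_rigid : ∀ (ℓ : ℕ) [Fact ℓ.Prime] (h : ℓ ∈ good)
    (k : Type) [Field k] [Fintype k] [CharP k ℓ] [TopologicalSpace k] [DiscreteTopology k]
    (ρ' : FramedGaloisRep ℚ k 4)
    (red : (Valued.v : Valuation (PadicAlgCl ℓ) NNReal).valuationSubring →+* AlgebraicClosure k),
    ReducesAlong ℓ red (companion ℓ h) ρ' → IrredOnCycKernel ℓ ρ'

/-- Every companion is unramified at almost every place (read off `CompanionAE` for some
`ι' : ℚ̄_ℓ ≃ ℂ`, which exists). [folklore] -/
theorem SingerFamily.companion_unramified {p : ℕ} [Fact p.Prime] {ρ : FramedGaloisRep ℚ (ZMod p) 4}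
    (𝓕 : SingerFamily p ρ) {ℓ : ℕ} [Fact ℓ.Prime] (h : ℓ ∈ 𝓕.good) :
    ∀ᶠ v : HeightOneSpectrum (𝓞 ℚ) in Filter.cofinite, (𝓕.companion ℓ h).IsUnramifiedAt v := by
  obtain ⟨ι'⟩ := PadicAlgCl.nonempty_ringEquiv_complex ℓ
  obtain ⟨ι, hcomp⟩ := 𝓕.companion_compatible ℓ h ι'
  exact hcomp.mono fun v hv => hv.2.1

/-- **Stub `stub_familyTransfer` (registered signature, verbatim; skeleton v8).**  Automorphy moves
from the `ℓ`-adic companion at any `ℓ ∈ good` to the `p`-adic lift: the landed `stub_compatibleTransfer`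
(p153996) applied to `companion_compatible` — the same `π`, read through the `ι` that `CompanionAE`
supplies. [folklore] -/
theorem stub_familyTransfer :
    ∀ (p : ℕ) [Fact p.Prime] (ρ : FramedGaloisRep ℚ (ZMod p) 4) (𝓕 : SingerFamily p ρ)
      (ℓ : ℕ) [Fact ℓ.Prime] (h : ℓ ∈ 𝓕.good),
      AutomorphicAE ℓ (𝓕.companion ℓ h) → AutomorphicAE p 𝓕.lift := by
  intro p _ ρ 𝓕 ℓ _ h haut
  exact stub_compatibleTransfer p ℓ 𝓕.lift (𝓕.companion ℓ h) (𝓕.companion_compatible ℓ h) haut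

end

end Summit.Langlands.Langlands.Cruxes.SerreGSp4Surjective.SingerTypeEvaporation
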